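import Summits.KontsevichZagierPeriods.Zeta5Search.LaiSweepShard

/-!
# `κ₃` sweep certificate — shard file 119 of 127 (shards 833–839 of 889)

HONEST FRAMING. Systematic search; no irrationality claim unless certified. This file only checks,
by `decide +kernel`, shards 833–839 of the order-cell sweep of the `κ₃` point `(74, 2180, 444; δ74)`
(engine `LaiSweepEngine`, soundness `LaiSweepJump/Free/Eval/Shard/Kappa3`; a shard is `⟨regime, n,
p, q, p', q', Lo, Up⟩`: `n` cells from `p/q` to `p'/q'` with integer rate sums in `[Lo, Up]`, `K =
128`, `D = 2^40`). It draws NO conclusion: only the capstone `LaiKappa3SweepCert`, which needs all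
127 shard files, does. Kernel cost of this file ≈ 560 cells × 0.3 s.
-/

namespace Summit.KontsevichZagierPeriods.Zeta5Search.Sweep

set_option maxHeartbeats 100000000 in
/-- Shard 833: 80 cells of regime B from `1117/1201` to `339/364`.
[cite: Lai2024BallRivoal, §4 Lemma 4.3] -/
theorem shard833 :
    Shard.check 128 (2^40)
      ⟨true, 80, 1117, 1201, 339, 364, 10315015156263, 17869864889605⟩ = true := by
  decide +kernel

set_option maxHeartbeats 100000000 in
/-- Shard 834: 80 cells of regime B from `339/364` to `318/341`.
[cite: Lai2024BallRivoal, §4 Lemma 4.3] -/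
theorem shard834 :
    Shard.check 128 (2^40)
      ⟨true, 80, 339, 364, 318, 341, 10078814892587, 17478457778884⟩ = true := by
  decide +kernel

set_option maxHeartbeats 100000000 in
/-- Shard 835: 80 cells of regime B from `318/341` to `395/423`.
[cite: Lai2024BallRivoal, §4 Lemma 4.3] -/
theorem shard835 :
    Shard.check 128 (2^40)
      ⟨true, 80, 318, 341, 395, 423, 10254241761855, 17800894499479⟩ = true := by
  decide +kernel

set_option maxHeartbeats 100000000 in
/-- Shard 836: 80 cells of regime B from `395/423` to `72/77`.
[cite: Lai2024BallRivoal, §4 Lemma 4.3] -/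
theorem shard836 :
    Shard.check 128 (2^40)
      ⟨true, 80, 395, 423, 72, 77, 10279843816487, 17863549641029⟩ = true := by
  decide +kernel

set_option maxHeartbeats 100000000 in
/-- Shard 837: 80 cells of regime B from `72/77` to `250/267`.
[cite: Lai2024BallRivoal, §4 Lemma 4.3] -/
theorem shard837 :
    Shard.check 128 (2^40)
      ⟨true, 80, 72, 77, 250, 267, 10318528310767, 17949288291289⟩ = true := by
  decide +kernel

set_option maxHeartbeats 100000000 in
/-- Shard 838: 80 cells of regime B from `250/267` to `331/353`.
[cite: Lai2024BallRivoal, §4 Lemma 4.3] -/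
theorem shard838 :
    Shard.check 128 (2^40)
      ⟨true, 80, 250, 267, 331, 353, 10985870826296, 19130634443744⟩ = true := by
  decide +kernel

set_option maxHeartbeats 100000000 in
/-- Shard 839: 80 cells of regime B from `331/353` to `261/278`.
[cite: Lai2024BallRivoal, §4 Lemma 4.3] -/
theorem shard839 :
    Shard.check 128 (2^40)
      ⟨true, 80, 331, 353, 261, 278, 9547958300848, 16643667472316⟩ = true := by
  decide +kernel

/-- The checked shards of this file, in order. [folklore] -/
def shards119 : List (CheckedShard 128 (2^40)) :=
  [⟨_, shard833⟩, ⟨_, shard834⟩, ⟨_, shard835⟩, ⟨_, shard836⟩, ⟨_, shard837⟩,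
    ⟨_, shard838⟩, ⟨_, shard839⟩]

end Summit.KontsevichZagierPeriods.Zeta5Search.Sweep
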